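import Literature.NumberTheory.EllipticCurves.FormalInvXExpansionProofs
import Literature.NumberTheory.EllipticCurves.PadicLogOfEvalProofs
import HarnessLib

/-!
# `z` and `i(z)` are the roots of `T² − S(1/x)·T + E(1/x)`: the formal Vieta relations over
# `R⟦1/x⟧`, and the even sigma function read through `1/x` (proofs only)

Topic `Literature/NumberTheory/EllipticCurves` (trunk T-NT-EC); PROOFS file (theorems only: no
definition, no named fact, no instance). Sequel of `FormalInvXExpansionProofs.lean`
(`formalInvX = 1/x(z) = z²·w/z³`, `IsInvXExpansion`, uniqueness/existence of the `x⁻¹`-expansion) and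
`FormalGroupNegProofs.lean` (the formal inverse `i = formalNeg = −z/(1 − a₁z − a₃w)`). Written by the
width seat `bsd-line-cf2-p1-w8` (g26) of the BSD cell `bsd-print-cf2` as the FORMAL core of the
comparison «cyclotomic `p`-adic height over a number field `H` at a point with rational
`x`-coordinate = minus-twist receptacle» (`CanonicalPAdicHeightCyc.lean`): the norm and the trace of
the formal parameter `z` down to the subring `R⟦1/x⟧` of `i`-invariants.

## Results (every commutative ring `R`, every Weierstrass curve `W/R`)

Write `X = z²x(z)` (`formalXMulSq`), `u = w/z³` (`formalWDivCube`, `u·X = 1`), `ι = 1/x = z²u`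
(`formalInvX`), `N = 1 − a₁z − a₃w`, `i = −z/N` (`formalNeg`), `D(w) = 1 + a₂w + a₄w² + a₆w³`,
`g(x) = x³D(1/x) = x³ + a₂x² + a₄x + a₆`.

* `formalXMulSq_mul_cubicD_formalInvX` — **`X · D(ι) = N`**, i.e. `x³D(1/x)·z² = g(x)z² = 1 − a₁z − a₃w`
  — the curve relation `u = 1 + a₁zu + a₂z²u + a₃z³u² + a₄z⁴u² + a₆z⁶u³` (`formalWDivCube_eq`).
* `formalNeg_mul_formalNegDenom` — `i · N = −z`; hence `formalXMulSq_mul_cubicD_mul_formalNeg`: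
  `X · D(ι) · i = −z`, and `formalXMulSq_mul_cubicD_mul_invOfUnit` : `X · D(ι) · N⁻¹ = 1`.
* **Vieta** (`prodSeries_subst_formalInvX`, `sumSeries_subst_formalInvX`): the series
  `E(w) = −w/D(w)` and `S(w) = −(a₁w + a₃w²)/D(w)` of `R⟦w⟧` satisfy
  `E(1/x(z)) = z · i(z)` and `S(1/x(z)) = z + i(z)` — on the curve, `z·z̄ = x²/(yȳ) = −x²/g(x)` and
  `z + z̄ = −x(a₁x + a₃)/g(x)` for the two points `±P = (x, y), (x, ȳ)`, `ȳ = −y − a₁x − a₃`, above `x`.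
* For an EVEN `Σ = z² + ⋯` (`IsFormallyEven`) with `x⁻¹`-expansion `𝔖` (`IsInvXExpansion Σ 𝔖`), writing
  `Σ = z²·S` (`S = sigmaShift (sigmaShift Σ)`, `S(0) = 1`) and `𝔖 = w·𝔖₁`:
  `sigmaShift_invX_subst_formalInvX` — **`𝔖₁(1/x) = S · X`**; `shift_subst_formalNeg_mul` —
  `S(i(z)) · N⁻² = S`; and the key `shift_subst_formalNeg_eq` — **`S(i(z)) = S · X² · D(ι)²`**, whence
  `sq_sigmaShift_invX_subst_mul` — **`𝔖₁(1/x)² · D(1/x)² = S · S(i(z))`**: the norm of `Σ/z²` down to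
  `R⟦1/x⟧` is `(𝔖(w)/w)² · D(w)²` read at `w = 1/x`.

These identities are what makes `Σ_{w∣p} log_p N_{H_w/ℚ_p} Σ_p(z(P)) = [H:ℚ]·log_p 𝔖_p(1/x(P))`
a formal consequence of evenness for a point with rational `x(P)` (the analytic half is
`PadicLogOfEvalProofs.lean`). Nothing about heights or BSD is proved here.

## References

* J. H. Silverman, *The Arithmetic of Elliptic Curves*, 2nd ed. (2009), IV.1 (`x = z/w`, `w/z³`,
  `i(z)`, `x(i(z)) = x(z)`), III.2.3 (negation `(x, −y − a₁x − a₃)`). [SilvermanAEC2009]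
* J. H. Silverman, Math. Ann. 332 (2005), §5 Thm. 11 and Rem. 2 (`σ²` even). [Silverman2005DivPoly]
* B. Mazur, W. Stein, J. Tate, Doc. Math. Extra Vol. Coates (2006), §1 (1.1), §2.8. [MazurSteinTate2006]
-/

noncomputable section

open scoped Classical
open PowerSeries Literature.NumberTheory.EllipticCurves

namespace WeierstrassCurve

variable {R : Type*} [CommRing R] (W : WeierstrassCurve R)

/-! ### §1 The curve relation read through `1/x`: `X · D(1/x) = 1 − a₁z − a₃w` -/

/-- **`z²x · (1 + a₂/x + a₄/x² + a₆/x³) = 1 − a₁z − a₃w`** in `R⟦z⟧ (i.e. `g(x)·z²/x² = 1 − a₁z − a₃w`,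
`g(x) = x³ + a₂x² + a₄x + a₆ = y(y + a₁x + a₃)`): the curve relation for `u = w/z³`
(`formalWDivCube_eq`) rewritten with `u · (z²x) = 1`. [cite: SilvermanAEC2009, IV.1.1] -/
theorem formalXMulSq_mul_cubicD_formalInvX :
    W.formalXMulSq * (1 + C W.a₂ * W.formalInvX + C W.a₄ * W.formalInvX ^ 2 +
        C W.a₆ * W.formalInvX ^ 3) = 1 - C W.a₁ * X - C W.a₃ * W.formalW := by
  have hE := W.formalWDivCube_eq
  have hBX := W.formalWDivCube_mul_formalXMulSq
  rw [formalInvX, W.formalW_eq_X_pow_mul_formalWDivCube]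
  linear_combination (-W.formalXMulSq) * hE +
    (1 - C W.a₁ * X - C W.a₃ * X ^ 3 * W.formalWDivCube) * hBX

/-- **`z²x · D(1/x) · i(z) = −z`**: the product of §1 and the tree's `formalNeg_mul_formalNegDenom`
(`i·(1 − a₁z − a₃w) = −z`). [cite: SilvermanAEC2009, IV.1.1] -/
theorem formalXMulSq_mul_cubicD_mul_formalNeg :
    W.formalXMulSq * (1 + C W.a₂ * W.formalInvX + C W.a₄ * W.formalInvX ^ 2 +
        C W.a₆ * W.formalInvX ^ 3) * W.formalNeg = -X := by
  rw [formalXMulSq_mul_cubicD_formalInvX, mul_comm, W.formalNeg_mul_formalNegDenom]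

/-- `z²x · D(1/x) · (1 − a₁z − a₃w)⁻¹ = 1`. [cite: SilvermanAEC2009, IV.1.1] -/
theorem formalXMulSq_mul_cubicD_mul_invOfUnit :
    W.formalXMulSq * (1 + C W.a₂ * W.formalInvX + C W.a₄ * W.formalInvX ^ 2 +
        C W.a₆ * W.formalInvX ^ 3) * invOfUnit (1 - C W.a₁ * X - C W.a₃ * W.formalW) 1 = 1 := by
  rw [formalXMulSq_mul_cubicD_formalInvX, W.formalNegDenom_mul_invOfUnit]

/-- Substituting `1/x` into the cubic `D(w) = 1 + a₂w + a₄w² + a₆w³`. [cite: SilvermanAEC2009, IV.1.1] -/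
theorem cubicD_subst_formalInvX :
    (1 + C W.a₂ * X + C W.a₄ * X ^ 2 + C W.a₆ * X ^ 3 : R⟦X⟧).subst W.formalInvX =
      1 + C W.a₂ * W.formalInvX + C W.a₄ * W.formalInvX ^ 2 + C W.a₆ * W.formalInvX ^ 3 := by
  have hs := W.hasSubst_formalInvX
  simp only [← coe_substAlgHom hs, map_add, map_mul, map_pow, map_one, substAlgHom_X]
  simp only [coe_substAlgHom hs, subst_C]
  rfl

/-- The cubic `D(w)` times its inverse is `1` (`D(0) = 1`). [cite: SilvermanAEC2009, IV.1.1] -/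
theorem cubicD_mul_invOfUnit :
    (1 + C W.a₂ * X + C W.a₄ * X ^ 2 + C W.a₆ * X ^ 3 : R⟦X⟧) *
      invOfUnit (1 + C W.a₂ * X + C W.a₄ * X ^ 2 + C W.a₆ * X ^ 3 : R⟦X⟧) 1 = 1 :=
  mul_invOfUnit _ 1 (by simp)

/-! ### §2 Vieta: `E(1/x) = z·i(z)` and `S(1/x) = z + i(z)` -/

/-- **The product of the roots: `E(1/x(z)) = z · i(z)`** for `E(w) = −w · D(w)⁻¹ ∈ R⟦w⟧` — on the
curve, `z(P)·z(−P) = (−x/y)(−x/ȳ) = x²/(yȳ) = −x²/g(x) = −(1/x)/D(1/x)` with `ȳ = −y − a₁x − a₃`,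
`yȳ = −g(x)`. [cite: SilvermanAEC2009, IV.1.1] [cite: MazurSteinTate2006, §1 eq. (1.1)] -/
theorem prodSeries_subst_formalInvX :
    (-(X * invOfUnit (1 + C W.a₂ * X + C W.a₄ * X ^ 2 + C W.a₆ * X ^ 3 : R⟦X⟧) 1)).subst
        W.formalInvX = X * W.formalNeg := by
  have hs := W.hasSubst_formalInvX
  set Dw : R⟦X⟧ := 1 + C W.a₂ * X + C W.a₄ * X ^ 2 + C W.a₆ * X ^ 3 with hDw
  set Dι := 1 + C W.a₂ * W.formalInvX + C W.a₄ * W.formalInvX ^ 2 + C W.a₆ * W.formalInvX ^ 3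
    with hDι
  set Dwi := (invOfUnit Dw 1).subst W.formalInvX with hDwi
  have hDsub : Dw.subst W.formalInvX = Dι := W.cubicD_subst_formalInvX
  -- `D(ι) · (D⁻¹)(ι) = 1`
  have h1 : Dι * Dwi = 1 := by
    have h := congrArg (PowerSeries.subst W.formalInvX) W.cubicD_mul_invOfUnit
    rwa [subst_mul hs, hDsub, one_subst_of_constantCoeff W.constantCoeff_formalInvX] at h
  have h2 := W.formalWDivCube_mul_formalXMulSq
  have h3 : W.formalXMulSq * Dι * W.formalNeg = -X := W.formalXMulSq_mul_cubicD_mul_formalNeg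
  have hι : W.formalInvX = X ^ 2 * W.formalWDivCube := rfl
  have hneg : (-(X * invOfUnit Dw 1)).subst W.formalInvX = -(W.formalInvX * Dwi) := by
    rw [hDwi, ← coe_substAlgHom hs, map_neg, map_mul, substAlgHom_X]
  rw [hneg]
  linear_combination (-(X * W.formalWDivCube * Dwi)) * h3 +
    (X * W.formalNeg * Dι * Dwi) * h2 + (X * W.formalNeg) * h1 + (-Dwi) * hι

/-- **The sum of the roots: `S(1/x(z)) = z + i(z)`** for `S(w) = −(a₁w + a₃w²) · D(w)⁻¹ ∈ R⟦w⟧` —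
on the curve, `z(P) + z(−P) = −x(y + ȳ)/(yȳ) = −x(a₁x + a₃)/g(x)`.
[cite: SilvermanAEC2009, IV.1.1] [cite: MazurSteinTate2006, §1 eq. (1.1)] -/
theorem sumSeries_subst_formalInvX :
    (-((C W.a₁ * X + C W.a₃ * X ^ 2) *
        invOfUnit (1 + C W.a₂ * X + C W.a₄ * X ^ 2 + C W.a₆ * X ^ 3 : R⟦X⟧) 1)).subst W.formalInvX =
      X + W.formalNeg := by
  have hs := W.hasSubst_formalInvX
  set Dw : R⟦X⟧ := 1 + C W.a₂ * X + C W.a₄ * X ^ 2 + C W.a₆ * X ^ 3 with hDw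
  set Dι := 1 + C W.a₂ * W.formalInvX + C W.a₄ * W.formalInvX ^ 2 + C W.a₆ * W.formalInvX ^ 3
    with hDι
  set Dwi := (invOfUnit Dw 1).subst W.formalInvX with hDwi
  have hDsub : Dw.subst W.formalInvX = Dι := W.cubicD_subst_formalInvX
  have h1 : Dι * Dwi = 1 := by
    have h := congrArg (PowerSeries.subst W.formalInvX) W.cubicD_mul_invOfUnit
    rwa [subst_mul hs, hDsub, one_subst_of_constantCoeff W.constantCoeff_formalInvX] at h
  have h2 := W.formalWDivCube_mul_formalXMulSq
  have h3 : W.formalXMulSq * Dι * W.formalNeg = -X := W.formalXMulSq_mul_cubicD_mul_formalNeg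
  have hB1 : W.formalXMulSq * Dι = 1 - C W.a₁ * X - C W.a₃ * W.formalW :=
    W.formalXMulSq_mul_cubicD_formalInvX
  have hNunit : IsUnit (W.formalXMulSq * Dι) := by
    rw [hB1]; exact IsUnit.of_mul_eq_one _ W.formalNegDenom_mul_invOfUnit
  have hι : W.formalInvX = X ^ 2 * W.formalWDivCube := rfl
  have hneg : (-((C W.a₁ * X + C W.a₃ * X ^ 2) * invOfUnit Dw 1)).subst W.formalInvX =
      -((C W.a₁ * W.formalInvX + C W.a₃ * W.formalInvX ^ 2) * Dwi) := by
    rw [hDwi, ← coe_substAlgHom hs, map_neg, map_mul, map_add, map_mul, map_mul, map_pow,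
      substAlgHom_X]
    simp only [coe_substAlgHom hs, subst_C]
    rfl
  rw [hneg]
  refine (hNunit.mul_left_inj).mp ?_
  rw [W.formalW_eq_X_pow_mul_formalWDivCube] at hB1
  linear_combination (-((C W.a₁ * W.formalInvX + C W.a₃ * W.formalInvX ^ 2) * W.formalXMulSq)) * h1 +
    (-(C W.a₁ * X ^ 2 + C W.a₃ * X ^ 4 * W.formalWDivCube)) * h2 + (-1 : R⟦X⟧) * h3 +
    (-X) * hB1 +
    (-(W.formalXMulSq * (C W.a₁ + C W.a₃ * (W.formalInvX + X ^ 2 * W.formalWDivCube)))) * hι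

/-! ### §3 An even sigma function read through `1/x` -/

section Sigma

variable {W}
variable {Sq Sx : R⟦X⟧} (hinv : W.IsInvXExpansion Sq Sx) (h0 : constantCoeff Sq = 0)
  (h1 : coeff 1 Sq = 0) (h2 : coeff 2 Sq = 1)

include h0 h1 in
/-- `Σ = z² · S` with `S = sigmaShift (sigmaShift Σ)` when `Σ(0) = Σ′(0) = 0`.
[cite: MazurSteinTate2006, §1 eq. (1.1)] -/
theorem X_sq_mul_sigmaShift_sigmaShift : X ^ 2 * sigmaShift (sigmaShift Sq) = Sq := by
  have hc : constantCoeff (sigmaShift Sq) = 0 := by rw [constantCoeff_sigmaShift, h1]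
  rw [pow_two, mul_assoc, X_mul_sigmaShift hc, X_mul_sigmaShift h0]

include h2 in
/-- `S(0) = [z²]Σ = 1`. [cite: MazurSteinTate2006, §1 eq. (1.1)] -/
theorem constantCoeff_sigmaShift_sigmaShift : constantCoeff (sigmaShift (sigmaShift Sq)) = 1 := by
  rw [constantCoeff_sigmaShift, coeff_sigmaShift, h2]

include hinv h0 in
/-- `𝔖(0) = Σ(0) = 0` for the `x⁻¹`-expansion. [cite: Silverman2005DivPoly, §5 Rem. 2] -/
theorem constantCoeff_invX_eq_zero : constantCoeff Sx = 0 := by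
  have h := congrArg (coeff 0) hinv
  rw [show (0 : ℕ) = 2 * 0 from rfl, coeff_two_mul_subst_formalInvX, Finset.sum_range_zero, add_zero,
    mul_zero, coeff_zero_eq_constantCoeff_apply, coeff_zero_eq_constantCoeff_apply, h0] at h
  exact h

include hinv h0 h2 in
/-- `𝔖′(0) = [z²]Σ = 1` for the `x⁻¹`-expansion (`1/x = z² + ⋯`). [cite: Silverman2005DivPoly, §5 Rem. 2] -/
theorem coeff_one_invX_eq_one : coeff 1 Sx = 1 := by
  have h := congrArg (coeff 2) hinv
  rw [show (2 : ℕ) = 2 * 1 from rfl, coeff_two_mul_subst_formalInvX, Finset.sum_range_one, pow_zero,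
    coeff_zero_eq_constantCoeff_apply, constantCoeff_invX_eq_zero hinv h0, zero_mul, add_zero] at h
  rw [h, show 2 * 1 = 2 from rfl, h2]

include hinv h0 in
/-- `𝔖 = w · 𝔖₁` with `𝔖₁ = sigmaShift 𝔖`. [cite: Silverman2005DivPoly, §5 Rem. 2] -/
theorem X_mul_sigmaShift_invX : X * sigmaShift Sx = Sx :=
  X_mul_sigmaShift (constantCoeff_invX_eq_zero hinv h0)

include hinv h0 h1 in
/-- **`𝔖₁(1/x) · (w/z³) = S`**, i.e. `𝔖₁(1/x(z)) = z²x(z)·Σ(z)/z² = x·Σ`: from `w𝔖₁ = 𝔖`,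
`𝔖(1/x) = Σ = z²S` and `1/x = z²·(w/z³)`. [cite: Silverman2005DivPoly, §5 Rem. 2] [cite: SilvermanAEC2009, IV.1.1] -/
theorem sigmaShift_invX_subst_mul_formalWDivCube :
    (sigmaShift Sx).subst W.formalInvX * W.formalWDivCube = sigmaShift (sigmaShift Sq) := by
  have hs := W.hasSubst_formalInvX
  have h := congrArg (PowerSeries.subst W.formalInvX) (X_mul_sigmaShift_invX hinv h0)
  rw [subst_mul hs, subst_X hs] at h
  have h' : Sx.subst W.formalInvX = Sq := hinv
  rw [h', ← X_sq_mul_sigmaShift_sigmaShift h0 h1] at h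
  have hι : W.formalInvX = X ^ 2 * W.formalWDivCube := rfl
  apply PowerSeries.X_pow_mul_cancel (k := 2)
  linear_combination h + (-((sigmaShift Sx).subst W.formalInvX)) * hι

include hinv h0 h1 in
/-- **`𝔖₁(1/x) = S · (z²x)`** (the previous identity times `z²x`, using `(w/z³)·(z²x) = 1`).
[cite: Silverman2005DivPoly, §5 Rem. 2] [cite: SilvermanAEC2009, IV.1.1] -/
theorem sigmaShift_invX_subst_formalInvX :
    (sigmaShift Sx).subst W.formalInvX = sigmaShift (sigmaShift Sq) * W.formalXMulSq := by
  have h := sigmaShift_invX_subst_mul_formalWDivCube hinv h0 h1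
  have hBX := W.formalWDivCube_mul_formalXMulSq
  linear_combination W.formalXMulSq * h + (-((sigmaShift Sx).subst W.formalInvX)) * hBX

variable (heven : W.IsFormallyEven Sq)

include heven h0 h1 in
/-- **Evenness on `S = Σ/z²`: `S(i(z)) · N⁻² = S`**, `N = 1 − a₁z − a₃w`, `i = −z/N`: from
`Σ(i(z)) = Σ(z)`, `Σ = z²S` and `i² = z²N⁻²`. [cite: Silverman2005DivPoly, §5 Rem. 2] [cite: SilvermanAEC2009, IV.1.1] -/
theorem shift_subst_formalNeg_mul :
    (sigmaShift (sigmaShift Sq)).subst W.formalNeg *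
        invOfUnit (1 - C W.a₁ * X - C W.a₃ * W.formalW) 1 ^ 2 = sigmaShift (sigmaShift Sq) := by
  have hs := W.hasSubst_formalNeg
  have h : Sq.subst W.formalNeg = Sq := heven
  rw [← X_sq_mul_sigmaShift_sigmaShift h0 h1, subst_mul hs, subst_pow hs, subst_X hs] at h
  have hi := W.formalNeg_eq
  set T := (sigmaShift (sigmaShift Sq)).subst W.formalNeg
  set Ni := invOfUnit (1 - C W.a₁ * X - C W.a₃ * W.formalW) 1
  apply PowerSeries.X_pow_mul_cancel (k := 2)
  linear_combination h + (T * (X * Ni - W.formalNeg)) * hi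

include heven h0 h1 in
/-- **`S(i(z)) = S · (z²x)² · D(1/x)²`** (`N⁻¹ = z²x·D(1/x)` by §1): the conjugate of `S = Σ/z²`
under `z ↦ i(z)`, written over `R⟦1/x⟧`. [cite: Silverman2005DivPoly, §5 Rem. 2] [cite: SilvermanAEC2009, IV.1.1] -/
theorem shift_subst_formalNeg_eq :
    (sigmaShift (sigmaShift Sq)).subst W.formalNeg =
      sigmaShift (sigmaShift Sq) * W.formalXMulSq ^ 2 *
        (1 + C W.a₂ * W.formalInvX + C W.a₄ * W.formalInvX ^ 2 + C W.a₆ * W.formalInvX ^ 3) ^ 2 := by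
  have hA := shift_subst_formalNeg_mul h0 h1 heven
  have hB := W.formalXMulSq_mul_cubicD_mul_invOfUnit
  set Ni := invOfUnit (1 - C W.a₁ * X - C W.a₃ * W.formalW) 1
  set Dι := 1 + C W.a₂ * W.formalInvX + C W.a₄ * W.formalInvX ^ 2 + C W.a₆ * W.formalInvX ^ 3
  set T := (sigmaShift (sigmaShift Sq)).subst W.formalNeg
  linear_combination (W.formalXMulSq ^ 2 * Dι ^ 2) * hA +
    (-(T * (W.formalXMulSq * Dι * Ni + 1))) * hB

include heven hinv h0 h1 in
/-- **`𝔖₁(1/x)² · D(1/x)² = S · S(i(z))`**: the «norm» of `S = Σ/z²` from `R⟦z⟧` down to the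
`i`-invariants `R⟦1/x⟧` is the square of `x·Σ·D(1/x)… = (𝔖(w)/w)·D(w)` at `w = 1/x` — the formal
identity behind `N_{F′_𝔓/ℚ_p} Σ_p(z) = 𝔖_p(1/x)²` for a point with rational `x` on the minus part of a
quadratic twist. [cite: Silverman2005DivPoly, §5 Rem. 2] [cite: MazurSteinTate2006, §2.8] -/
theorem sq_sigmaShift_invX_subst_mul :
    (sigmaShift Sx).subst W.formalInvX ^ 2 *
        (1 + C W.a₂ * W.formalInvX + C W.a₄ * W.formalInvX ^ 2 + C W.a₆ * W.formalInvX ^ 3) ^ 2 =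
      sigmaShift (sigmaShift Sq) * (sigmaShift (sigmaShift Sq)).subst W.formalNeg := by
  rw [sigmaShift_invX_subst_formalInvX hinv h0 h1, shift_subst_formalNeg_eq h0 h1 heven]
  ring

end Sigma

end WeierstrassCurve

end
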